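import Summits.Ventures.LatticeQCDFlow.Scoring.PooledESS

/-!
# Kish ESS versus the delta-method effective sample size of a reweighted mean (AGREEMENT-AB residue R-SD-1)

HONEST FRAMING: exact (Metropolis-corrected) sampling algorithms for lattice gauge theory;
figures of merit are autocorrelation/cost numbers at stated couplings and volumes; no
continuum-physics claim.

Venture `LatticeQCDFlow` (cell pub-lqcd), sub-topic `Scoring`; FANOUT row 11 (`eng-scorerA`,
fitness scorer A), GEN-12.  NEW WORK of the cell (finite algebra; nothing cited as a tree fact).

## Why

The two frozen scorers guard the LEADERBOARD-2 key-free tests on reweight (NE / IMH-proposal) rows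
with an effective-sample-size floor `n_eff ≥ 50` (arbiter Ruling 1 P3 for `sd_re`, Ruling 7 D2 for
the free-energy bracket), but compute `n_eff` differently — the one residue class (R-SD-1) of the
A-vs-B candidate agreement (HOME/eng-scorera/docket-L2-A15/README ADDENDUM 4):

* scorer B: the Kish effective sample size of the weights, `Kish(w) = (Σ w)² / Σ w²` — the tree's
  `kishESS` of `Scoring/PooledESS.lean` (row 11 GEN-6), used here over `Finset.univ`;
* scorer A: `n_eff = var_w / err²` where `err` is the Γ-method error of the ratio estimator
  `m = Σ wᵢoᵢ / Σ wᵢ` (`estimators.analyse_reweight_obs`); for an UNCORRELATED sample the Γ error is the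
  delta-method (linearisation) variance `Σ wᵢ²(oᵢ − m)² / (Σ wᵢ)²` (the projected series of
  `uwerr_derived` is `hᵢ = (wᵢ/w̄)(oᵢ − m)`), so A's number is
  `deltaESS(w,o) = var_w / deltaVar`, `var_w = Σ wᵢ(oᵢ − m)² / Σ wᵢ` — times `1/(2τ_int)` when the
  sample is autocorrelated, which only lowers it further.

## What is typed (weights `w`, values `o` on a finite index type; `m` is ANY centre — the identities
## are algebraic, the scorer uses the weighted mean)

* `deltaESS_eq_kish_mul_ratio` — **`deltaESS = Kish · (w-average of the squared deviations) /
  (w²-average of the squared deviations)`**: the two agree exactly when the squared deviations are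
  "uncorrelated with the weights" in this precise sense, A's is SMALLER than Kish when the heavily
  weighted samples carry the larger deviations (the typical importance-sampling situation: large
  weights sit on atypical proposals) and LARGER in the opposite case;
* `deltaESS_eq_kish_of_const_dev` — equal squared deviations ⇒ `deltaESS = Kish`;
* two-sample witnesses with numbers: weights `(3, 1)`, squared deviations `(4, 1)` ⇒ `Kish = 8/5`,
  `deltaESS = 52/37 < 8/5` (`deltaESS_lt_kish_example`); squared deviations `(1, 4)` ⇒
  `deltaESS = 28/13 > 8/5` (`kish_lt_deltaESS_example`).

So neither number dominates the other in general; on row 24's dsnfb dry run A printed 7.8 / 24.8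
where B printed 5.0 / 64.0 (the second pair is the flat-weight X-3 twin, where Kish = N and A's Γ
error also carries the autocorrelation factor).  What is NOT here: autocorrelation (the `1/(2τ)`
factor), and any claim about which floor the arbiter should adopt.
-/

namespace Summit.Ventures.LatticeQCDFlow.Scoring

open Finset

variable {ι : Type*} [Fintype ι]

/-- Weighted variance about the centre `m`: `var_w = Σ wᵢ (oᵢ − m)² / Σ wᵢ` (scorer A's
`weighted_mean_var`). -/
noncomputable def wVar (w o : ι → ℝ) (m : ℝ) : ℝ := (∑ i, w i * (o i - m) ^ 2) / ∑ i, w i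

/-- Delta-method (linearisation) variance of the self-normalised ratio estimator for an uncorrelated
sample: `Σ wᵢ² (oᵢ − m)² / (Σ wᵢ)²` (= the Γ-method value at `τ = 1/2`). -/
noncomputable def deltaVar (w o : ι → ℝ) (m : ℝ) : ℝ := (∑ i, w i ^ 2 * (o i - m) ^ 2) / (∑ i, w i) ^ 2

/-- Scorer A's effective sample size for a reweighted mean (uncorrelated case): `var_w / deltaVar`. -/
noncomputable def deltaESS (w o : ι → ℝ) (m : ℝ) : ℝ := wVar w o m / deltaVar w o m

/-- **`deltaESS = Kish × (w-average of dev²) / (w²-average of dev²)`**, whenever the sums involved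
are nonzero: `deltaESS = Kish · [(Σ w dev²)/(Σ w)] / [(Σ w² dev²)/(Σ w²)]`. -/
theorem deltaESS_eq_kish_mul_ratio (w o : ι → ℝ) (m : ℝ) (hw : ∑ i, w i ≠ 0)
    (hw2 : ∑ i, w i ^ 2 ≠ 0) (hd : ∑ i, w i ^ 2 * (o i - m) ^ 2 ≠ 0) :
    deltaESS w o m
      = kishESS univ w * (((∑ i, w i * (o i - m) ^ 2) / ∑ i, w i)
          / ((∑ i, w i ^ 2 * (o i - m) ^ 2) / ∑ i, w i ^ 2)) := by
  unfold deltaESS wVar deltaVar kishESS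
  field_simp

/-- Equal squared deviations `dev² ≡ s` (any `s ≠ 0`) ⇒ `deltaESS = Kish` exactly. -/
theorem deltaESS_eq_kish_of_const_dev (w o : ι → ℝ) (m s : ℝ) (hs : s ≠ 0)
    (hdev : ∀ i, (o i - m) ^ 2 = s) (hw : ∑ i, w i ≠ 0) (hw2 : ∑ i, w i ^ 2 ≠ 0) :
    deltaESS w o m = kishESS univ w := by
  unfold deltaESS wVar deltaVar kishESS
  simp_rw [hdev]
  rw [← Finset.sum_mul, ← Finset.sum_mul]
  field_simp

/-! ### Two-sample witnesses: neither number dominates the other -/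

/-- Weights `(3, 1)`. -/
def wEx : Fin 2 → ℝ := ![3, 1]
/-- Values `(2, 1)` with centre `0`: squared deviations `(4, 1)` — the HEAVY sample deviates MORE. -/
def oHeavyFar : Fin 2 → ℝ := ![2, 1]
/-- Values `(1, 2)` with centre `0`: squared deviations `(1, 4)` — the heavy sample deviates LESS. -/
def oHeavyNear : Fin 2 → ℝ := ![1, 2]

/-- `Kish(3, 1) = 16/10 = 8/5`. -/
theorem kishESS_example : kishESS univ wEx = 8 / 5 := by
  unfold kishESS wEx
  simp [Fin.sum_univ_two]
  norm_num

/-- Heavy sample far: `deltaESS = (13/4)/(37/16) = 52/37`. -/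
theorem deltaESS_heavyFar : deltaESS wEx oHeavyFar 0 = 52 / 37 := by
  unfold deltaESS wVar deltaVar wEx oHeavyFar
  simp [Fin.sum_univ_two]
  norm_num

/-- Heavy sample near: `deltaESS = (7/4)/(13/16) = 28/13`. -/
theorem deltaESS_heavyNear : deltaESS wEx oHeavyNear 0 = 28 / 13 := by
  unfold deltaESS wVar deltaVar wEx oHeavyNear
  simp [Fin.sum_univ_two]
  norm_num

/-- **A's number below Kish** when the heavy weights carry the large deviations: `52/37 < 8/5`. -/
theorem deltaESS_lt_kish_example : deltaESS wEx oHeavyFar 0 < kishESS univ wEx := by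
  rw [deltaESS_heavyFar, kishESS_example]
  norm_num

/-- **A's number above Kish** in the opposite case: `8/5 < 28/13`. -/
theorem kish_lt_deltaESS_example : kishESS univ wEx < deltaESS wEx oHeavyNear 0 := by
  rw [deltaESS_heavyNear, kishESS_example]
  norm_num

end Summit.Ventures.LatticeQCDFlow.Scoring
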